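import Mathlib
import Literature.LinearAlgebra.Alternating.WedgeWordsDet

/-!
# Route `TropicalKugaSatakeCayley`, support S5 `CayleyHodgeRankTwo` (stmt-HodgeConjecture-18573) — part B5:
# cancellation certificates for integral combinations of wedge monomials

The certified half of the cusp computation (part B). After part B4, the slotwise derivation of a monomial
table along a cusp operator is an explicit integral combination `Σ_{t,j,s} γ(t,j,s) • θ_{ω(t,j,s)}` of wedge
monomials of MODIFIED words `ω(t,j,s)` (a letter of an increasing word replaced by another letter), which
need not be increasing and may repeat a letter. Such a combination vanishes as soon as a finite
CERTIFICATE checks: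

* every term is tagged either `none` — then its coefficient is `0` or its word repeats a letter
  (`wedgeWord_eq_zero_of_not_injective`) — or `some (g, swaps)` — then applying the listed ADJACENT
  TRANSPOSITIONS `(p, p+1)` to its word yields the `g`-th reference word `Ω g`, so that
  `θ_ω = (-1)^{#swaps} θ_{Ω g}` (`wedgeWord_comp_perm`, `Equiv.Perm.sign_prod_list_swap`);
* for every reference word the signed coefficients `(-1)^{#swaps} γ` of its group sum to zero.

`tkc_cert_sum_eq_zero` is this statement; its three hypotheses are decidable propositions about finite
data, discharged by `decide` for the explicit tables of part B3 (the certificates themselves are produced by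
exact integer linear algebra outside Lean and merely CHECKED here). Theorems only: no definition, no named
fact, no sorry.

## References

* [Warner1983] F. W. Warner, Foundations of Differentiable Manifolds and Lie Groups (1983), 2.6 (alternation
  of wedge monomials in their letters).
-/

noncomputable section

set_option linter.dupNamespace false

namespace Summit.HodgeConjecture.HodgeConjecture.Theorems

open Literature.LinearAlgebra.Alternating

section Certificate

variable {𝕜 : Type*} [NontriviallyNormedField 𝕜] {𝕜' : Type*} [NormedField 𝕜'] [NormedAlgebra 𝕜 𝕜']
  {E : Type*} [NormedAddCommGroup E] [NormedSpace 𝕜 E] {F : Type*} [NormedAddCommGroup F]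
  [NormedSpace 𝕜 F] [NormedSpace 𝕜' F] [IsScalarTower 𝕜 𝕜' F]
  {σ : Type*} (θ : σ → (E →L[𝕜] 𝕜')) (c : E [⋀^Fin 0]→L[𝕜] F)

/-- **A product of adjacent transpositions has sign `(-1)^{length}`.** [folklore] -/
theorem tkc_sign_prod_adjacent_swaps {k : ℕ} (sw : List (Fin k)) :
    Equiv.Perm.sign ((sw.map fun p : Fin k => Equiv.swap p.castSucc p.succ).prod) = (-1) ^ sw.length := by
  have hl : ∀ g ∈ sw.map (fun p : Fin k => Equiv.swap p.castSucc p.succ), Equiv.Perm.IsSwap g := by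
    intro g hg
    rw [List.mem_map] at hg
    obtain ⟨p, -, rfl⟩ := hg
    exact ⟨p.castSucc, p.succ, Fin.castSucc_lt_succ.ne, rfl⟩
  rw [Equiv.Perm.sign_prod_list_swap hl, List.length_map]
  rfl

/-- **Reordering by a certified list of adjacent transpositions**: if `w ∘ (swaps) = w'` then
`θ_w ∧ c = (-1)^{#swaps} • (θ_{w'} ∧ c)`, pointwise. [cite: Warner1983, 2.6] -/
theorem tkc_wedgeWord_apply_eq_of_swaps {k : ℕ} (w w' : Fin (k + 1) → σ) (sw : List (Fin k))
    (h : w ∘ ⇑((sw.map fun p : Fin k => Equiv.swap p.castSucc p.succ).prod) = w') (u : Fin (k + 1) → E) :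
    wedgeWord θ c (k + 1) w u = (((-1 : ℤ) ^ sw.length : ℤ) : 𝕜') • wedgeWord θ c (k + 1) w' u := by
  have hperm := wedgeWord_comp_perm θ c w ((sw.map fun p : Fin k => Equiv.swap p.castSucc p.succ).prod)
  rw [h] at hperm
  have hsz : ((Equiv.Perm.sign ((sw.map fun p : Fin k => Equiv.swap p.castSucc p.succ).prod) : ℤˣ) : ℤ) =
      (-1 : ℤ) ^ sw.length := by
    rw [tkc_sign_prod_adjacent_swaps]
    rfl
  have hu := congrArg (fun f : E [⋀^Fin (k + 1)]→L[𝕜] F => f u) hperm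
  simp only [ContinuousAlternatingMap.smul_apply] at hu
  rw [hsz] at hu
  rw [hu, smul_smul, ← Int.cast_mul, ← pow_add, ← two_mul, pow_mul, neg_one_sq, one_pow, Int.cast_one,
    one_smul]

omit [NormedSpace 𝕜' F] [IsScalarTower 𝕜 𝕜' F] in
/-- Moving the innermost of four sums to the front. [folklore] -/
theorem tkc_sum_comm4 {m n r G : ℕ} (Fn : Fin m → Fin n → Fin r → Fin G → F) :
    (∑ t, ∑ j, ∑ s, ∑ g, Fn t j s g) = ∑ g, ∑ t, ∑ j, ∑ s, Fn t j s g := by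
  have h1 : ∀ t j, (∑ s, ∑ g, Fn t j s g) = ∑ g, ∑ s, Fn t j s g := fun t j => Finset.sum_comm
  have h2 : ∀ t, (∑ j, ∑ g, ∑ s, Fn t j s g) = ∑ g, ∑ j, ∑ s, Fn t j s g := fun t => Finset.sum_comm
  have h3 : (∑ t, ∑ g, ∑ j, ∑ s, Fn t j s g) = ∑ g, ∑ t, ∑ j, ∑ s, Fn t j s g := Finset.sum_comm
  simp only [h1, h2, h3]

/-- **Certificate lemma.** An integral combination `Σ_{t,j,s} γ(t,j,s) • (θ_{ω(t,j,s)} ∧ c)` of wedge monomials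
of words of length `k+1` vanishes if there are reference words `Ω g` (`g < G`) and tags
`tag t j s : Option (Fin G × List (Fin k))` such that: a term tagged `none` has coefficient `0` or a word
with a repeated letter; a term tagged `some (g, swaps)` has `ω ∘ Π (p, p+1)_{p ∈ swaps} = Ω g`; and for every
`g` the signed coefficients `(-1)^{#swaps} γ` of the terms tagged `g` sum to `0`. All three hypotheses are
decidable for explicit data. [cite: Warner1983, 2.6] -/
theorem tkc_cert_sum_eq_zero {k m r G : ℕ} (γ : Fin m → Fin (k + 1) → Fin r → ℤ)
    (ω : Fin m → Fin (k + 1) → Fin r → (Fin (k + 1) → σ)) (Ω : Fin G → (Fin (k + 1) → σ))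
    (tag : Fin m → Fin (k + 1) → Fin r → Option (Fin G × List (Fin k)))
    (hzero : ∀ t j s, tag t j s = none → γ t j s = 0 ∨ ¬ Function.Injective (ω t j s))
    (hgrp : ∀ t j s, ∀ y ∈ tag t j s,
      ω t j s ∘ ⇑((y.2.map fun p : Fin k => Equiv.swap p.castSucc p.succ).prod) = Ω y.1)
    (hsum : ∀ g : Fin G, (∑ t, ∑ j, ∑ s, (tag t j s).elim (0 : ℤ)
      (fun y => if y.1 = g then (-1) ^ y.2.length * γ t j s else 0)) = 0) :
    (∑ t, ∑ j, ∑ s, (γ t j s : 𝕜') • wedgeWord θ c (k + 1) (ω t j s)) = 0 := by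
  classical
  ext u
  simp only [ContinuousAlternatingMap.sum_apply, ContinuousAlternatingMap.smul_apply,
    ContinuousAlternatingMap.coe_zero, Pi.zero_apply]
  -- each term, rewritten over the reference words
  have hterm : ∀ t j s, (γ t j s : 𝕜') • wedgeWord θ c (k + 1) (ω t j s) u =
      ∑ g : Fin G, (((tag t j s).elim (0 : ℤ)
        (fun y => if y.1 = g then (-1) ^ y.2.length * γ t j s else 0) : ℤ) : 𝕜') •
          wedgeWord θ c (k + 1) (Ω g) u := by
    intro t j s
    rcases htag : tag t j s with _ | ⟨g, sw⟩
    · simp only [Option.elim, Int.cast_zero, zero_smul, Finset.sum_const_zero]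
      rcases hzero t j s htag with h0 | hinj
      · rw [h0, Int.cast_zero, zero_smul]
      · rw [wedgeWord_eq_zero_of_not_injective θ c (ω t j s) hinj,
          ContinuousAlternatingMap.coe_zero, Pi.zero_apply, smul_zero]
    · have hw := hgrp t j s (g, sw) (by rw [Option.mem_def, htag])
      simp only [Option.elim]
      rw [tkc_wedgeWord_apply_eq_of_swaps θ c (ω t j s) (Ω g) sw hw u, smul_smul, ← Int.cast_mul]
      have hite : ∀ g' : Fin G, (((if g = g' then (-1) ^ sw.length * γ t j s else 0 : ℤ) : ℤ) : 𝕜') •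
          wedgeWord θ c (k + 1) (Ω g') u =
          if g = g' then (((-1) ^ sw.length * γ t j s : ℤ) : 𝕜') • wedgeWord θ c (k + 1) (Ω g') u
          else 0 := by
        intro g'
        split_ifs <;> simp
      rw [Finset.sum_congr rfl fun g' _ => hite g', Finset.sum_ite_eq, if_pos (Finset.mem_univ g),
        mul_comm]
  simp only [hterm]
  -- exchange the sums and use the vanishing of the signed coefficient sums
  rw [tkc_sum_comm4]
  refine Finset.sum_eq_zero fun g _ => ?_
  have hcoef : (∑ t, ∑ j, ∑ s, (((tag t j s).elim (0 : ℤ)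
      (fun y => if y.1 = g then (-1) ^ y.2.length * γ t j s else 0) : ℤ) : 𝕜')) = 0 := by
    have h := congrArg (Int.cast (R := 𝕜')) (hsum g)
    push_cast at h
    exact h
  rw [show (∑ t, ∑ j, ∑ s, (((tag t j s).elim (0 : ℤ)
      (fun y => if y.1 = g then (-1) ^ y.2.length * γ t j s else 0) : ℤ) : 𝕜') •
        wedgeWord θ c (k + 1) (Ω g) u) =
      (∑ t, ∑ j, ∑ s, (((tag t j s).elim (0 : ℤ)
        (fun y => if y.1 = g then (-1) ^ y.2.length * γ t j s else 0) : ℤ) : 𝕜')) •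
          wedgeWord θ c (k + 1) (Ω g) u by simp only [Finset.sum_smul], hcoef, zero_smul]

end Certificate

end Summit.HodgeConjecture.HodgeConjecture.Theorems

end
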